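import Literature.MathematicalPhysics.QuantumFieldTheory.Balaban1983to89.B8Prop3BodyNotAtEmptyBonds
import Literature.MathematicalPhysics.QuantumFieldTheory.Balaban1983to89.B7Eq214FlatQprime

/-!
# `Balaban1983to89.B8Thm4BodyNotAtUnivLevelZero` — KERNEL CERTIFICATE: [Balaban1985RegularSpaces] THEOREM 4 AS TYPED on n05-a's family `B8LeafModelZd3.zdGF3`
# (`B8.Thm4Body c₁ B₁′`, EVERY threshold `c₁ > 0`, EVERY constant `B₁′`) is FALSE at members of `ZdIdx d L` with `Ω_j = ℤᵈ` whose constraint SITES are ALL AT LEVEL 0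
# (`Λs m j = ℤᵈ` iff `j = 0`) and enough levels (`Lᵏ > 4B₁′`) — so `B8.Thm4Printed B₁′` on the law-free univ sub-family `{i // i.Ω 0 = univ}` (and on all of `ZdIdx d L`)
# is FALSE as typed

statement-level skeleton of published theorems with citation tags; proofs where landed; nothing here is a claim about the
Yang–Mills mass gap

`[Balaban1985RegularSpaces]` ("B8", CMP **99** (1985) 75–102) Thm 4 p. 88, (1.29) p. 81, (1.33)–(1.38) p. 82, (1.62) p. 87, (1.66) p. 87, (1.3)–(1.6) p. 77 (the graded
constraint sets `Λ_j ⊂ Ω_j ∖ Ω_{j+1}`), p. 77 («Ω_j = T_η»); [Balaban1985Averaging] (11) p. 18 (gauge covariance of the averages).  PDF held: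
`paper:balaban1985-cmp99-regular-spaces-gauge-fixing`.

CITATION HEADER (lean-in-tree rule).  Cell `pub-ymgap` (YM Track A, HUMAN RULING D-0062), DAG node N16 = NE3 (consumer of node N05 = [B8]), seat
`pub-ymgap-dag-n16-c` (g6).  Third certificate of this seat's audit of the LAW-FREE univ index (after `B8SockH59NotAtUnivDegenerate` — the (1.59) socket at empty
lower-truncation data, law №8 of `B8IdxB8LawsB` — and `B8Prop3BodyNotAtEmptyBonds` — Proposition 3 at empty bond classes, law №12).  HERE law №11 (the graded
cover (1.5)–(1.6)): `ZdIdx` admits members with `Ω_j = ℤᵈ` for all `j` but ALL constraint sites at level 0 (`Λs m 0 = ℤᵈ`, `Λs m j = ∅` for `j ≥ 1`; `htower`∕`hpart` hold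
— every site is its own level-0 tower).  At such a member (1.29) `Restricted U₀ u` (`Restr129` at level 0: `R̄₀u⁰(y) = u(y) = 1`) forces the gauge transformation of Theorem
4's conclusion to be `u = 1`, the block axial gauge (1.34) `InAx` (levels `j ≥ 1` only) is vacuous, and the conclusion's (1.62) `C162 B₁′ (α₀+α₁)` then asks of the DATUM
`U′` itself `‖(iη)⁻¹ log U′_b‖ ≤ B₁′(α₀+α₁)(Lʲη)⁻¹` at EVERY level `j ≤ k` — in particular `≤ 2B₁′s(Lᵏη)⁻¹` at the top — while the hypotheses (1.33)∕(1.34)∕(1.66) only ask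
plaquette smallness, block-axiality above level 0 (vacuous) and `‖Ū′ʲ − Ū₀ʲ‖ ≤ α₁`, `‖U′ − 1‖ ≤ α₁`.  WITNESS at `U₀ = 1`, `α₀ = α₁ = s`: the pure gauge `U′ = gaugeAct w 1` of the
ONE-SITE bump `w(e_τ) = g`, `w = 1` elsewhere, `g = e^{iηa}`, `a = (s∕2η)·1`: plaquettes trivial ((1.33) by gauge invariance of `𝔄_k`, `B8Ineq132.inAk_gaugeAct_iff`); every
average `Ū′ʲ` is again a pure gauge ([Balaban1985Averaging] (11), `B7Prop6Flat.avgIter_gaugeAct_units`) with values in `{1, g, g⁻¹}`, all within `s` of `1`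
(`‖e^{X} − 1‖ ≤ 2‖X‖`, `B7Eq214FlatQprime.norm_exp_sub_one_le_two_mul`); but `U′(e_τ, τ) = g` has `‖(iη)⁻¹ log g‖ = s∕(2η)` (`B8Prop3GaugeFixedKLevel.logField_spec`), which
exceeds `2B₁′s(Lᵏη)⁻¹` as soon as `Lᵏ > 4B₁′`.  ★ `thm4Clause_false_of_levelZero` (the member clause), `exists_member_univ_levelZero`, ★★ `not_thm4Printed_zdGF3_univ`
(`L ≥ 2`: a member with `Lᵏ > 4B₁′` exists), `not_thm4Printed_zdGF3`, `not_thm4Printed_zdGF3H_univ`.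

CONSEQUENCE (recorded, count-neutral).  With `B8Prop3BodyNotAtEmptyBonds`: BOTH printed sentences N16 reads ([Balaban1985RegularSpaces] Thm 4, Prop 3) are FALSE AS TYPED on
the law-free univ sub-family of `zdGF3`; every theorem binding `B8.Thm4Printed`∕`B8.Thm4Body c₁` there is VACUOUS as stated; n05-a's `thm4Printed_zd3(_mapE at Subtype.val)`
has a false conclusion (its four socket binders are jointly unsatisfiable — consistent with `B8SockH59NotAtUnivDegenerate`).  NOT affected: node N05's record sub-index
`IdxB8SubB` (law №11 `cover` excludes the member: a level-1 tower has no constraint site above it) and the all-torus PROPER ∕ PINNED sub-indices of N16's files 45–48.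
PRINT IS CONSISTENT: (1.5)–(1.6) make `Λ_j` a graded partition subordinate to `{Ω_j}`; with `Ω_j = T_η` for all `j` the constraint sites sit at the TOP level, not at level 0.

HONEST SCOPE.  A negative typing certificate with an explicit witness; nothing of [Balaban1985RegularSpaces] is proved or refuted; count-neutral; N05 ∕ N16 NOT discharged;
SECOND-GAP: none; one finite `T⁴` programme at fixed `ε`, Bałaban as printed; nothing continuum ∕ ℝ⁴ ∕ OS ∕ mass-gap ∕ Clay.  No `sorry`, no `def`, no `instance`, no `notation`.
Unit `pub-ymgap-dag-n16-c` (g6), 2026-08-27.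
-/

noncomputable section

namespace Literature.MathematicalPhysics.QuantumFieldTheory.Balaban1983to89.B8Thm4BodyNotAtUnivLevelZero

open NormedSpace
open Complex (I)
open B7Prop1Explicit (e e_apply expUnit val_expUnit val_inv_expUnit gaugeAct)
open B7Prop2Explicit (unitaryUnits unitaryUnits_le_U1 avgIter avgIter_zero)
open B7Eq78Linearization (Rbar_zero)
open B7Eq92Concrete (mgauge mgauge_apply avgIter_one)
open B7AvgGaugeCovariance (uLev uLev_apply)
open B7Prop6Flat (avgIter_gaugeAct_units)
open B7Eq214FlatQprime (norm_exp_sub_one_le_two_mul)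
open B8Lemma1NonAbelian (mulCfg)
open B8Ineq132 (InAk inAk_gaugeAct_iff)
open B8Eq119TwistedAxial (InAx Restr129)
open B8Eq184Proof (cfgExp)
open B8Eq138LandauZd (logCfg)
open B8Eq140Level (SideTouches sideTouches_of_bondTouches)
open B7Prop1Local (InBox loK bondHiK)
open B8Ineq130 (tlo thi tlo_zero thi_zero)
open B8LeafModelZd (ZdIdx)
open B8LeafModelZd3 (zdGF3)
open B8LeafModelZd3H (zdGF3H)
open B8Prop6OfThm4 (one_inAk)
open B8Thm4Concrete (mulCfg_eq_mul)
open B8Prop3GaugeFixedKLevel (logField_spec)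

export B7Prop1Explicit (Site)

variable {d : ℕ}

/-! ## §1 ★ Theorem 4's clause at a member with `Ω ≡ ℤᵈ`, all constraint sites at level 0 and `Lᵏ > 4B₁′` is false, for every threshold -/

section Clause

variable {𝔸 : Type} [CStarAlgebra 𝔸] [Nontrivial 𝔸]

/-- ★ **THEOREM 4 AS TYPED IS FALSE AT A MEMBER OF `zdGF3` WITH `Ω_j = ℤᵈ`, ALL CONSTRAINT SITES AT LEVEL 0 AND `Lᵏ > 4B₁′`** (`d ≥ 2`, `L ≥ 1`, any Hölder data, EVERY
`c₁ > 0`, every `B₁′` with `4B₁′ < Lᵏ`): the clause of `B8.Thm4Body c₁ B₁′` at the member `i` (`∀ j, i.Ω j = univ`, `∀ m j, i.Λs m j = {j = 0}`) fails.  WITNESS (module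
docstring): `U₀ = 1`, `α₀ = α₁ = s := min (c₁∕2) (1∕16)`, `U′ = gaugeAct w 1` for the one-site bump `w(e_τ) = g = e^{iηa}`, `a = (s∕2η)·1`; (1.29) at level 0 forces the
conclusion's `u` to be `1`, and its (1.62) at the top level on the bond `(e_τ, τ)` (`U′ = g` there) reads `s∕(2η) ≤ 2B₁′s(Lᵏη)⁻¹`, i.e. `Lᵏ ≤ 4B₁′` — absurd.
[cite: Balaban1985RegularSpaces, Thm 4 p.88, (1.29) p.81, (1.33)–(1.34) p.82, (1.62) p.87, (1.66) p.87, (1.5)–(1.6) p.77; Balaban1985Averaging, (11) p.18] -/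
theorem thm4Clause_false_of_levelZero (hd2 : 2 ≤ d) {L : ℕ} (hL : 1 ≤ L) (β : ℝ) (len : Site d → ℝ) (i : ZdIdx d L)
    (hΩ : ∀ j, i.Ω j = Set.univ) (hΛs : ∀ m j, i.Λs m j = {_y | j = 0}) {c₁ B₁' : ℝ} (hc₁ : 0 < c₁) (hk : 4 * B₁' < (L : ℝ) ^ i.k) :
    ¬ (∀ α₀ α₁ : ℝ, 0 < α₀ → 0 < α₁ → α₀ + α₁ ≤ c₁ →
        ∀ U₀ : (zdGF3 𝔸 L β len i).Cfg, ∀ U' : (zdGF3 𝔸 L β len i).Pert,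
          (zdGF3 𝔸 L β len i).InA α₀ U₀ → (zdGF3 𝔸 L β len i).Reg335 α₀ U₀ → (zdGF3 𝔸 L β len i).InAAx α₀ U₀ U' →
          (zdGF3 𝔸 L β len i).avgClose166 α₁ U₀ U' →
            ∃ u : (zdGF3 𝔸 L β len i).GT, (zdGF3 𝔸 L β len i).Restricted U₀ u ∧
              ((zdGF3 𝔸 L β len i).C137 α₁ U₀ ((zdGF3 𝔸 L β len i).act U' u) ∧
                (zdGF3 𝔸 L β len i).Landau U₀ ((zdGF3 𝔸 L β len i).act U' u) ∧
                (zdGF3 𝔸 L β len i).C162 B₁' (α₀ + α₁) U₀ ((zdGF3 𝔸 L β len i).act U' u)) ∧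
              ∀ u' : (zdGF3 𝔸 L β len i).GT, (zdGF3 𝔸 L β len i).Restricted U₀ u' →
                (zdGF3 𝔸 L β len i).C137 α₁ U₀ ((zdGF3 𝔸 L β len i).act U' u') →
                (zdGF3 𝔸 L β len i).Landau U₀ ((zdGF3 𝔸 L β len i).act U' u') →
                (zdGF3 𝔸 L β len i).C162 B₁' (α₀ + α₁) U₀ ((zdGF3 𝔸 L β len i).act U' u') → u' = u) := by
  intro H
  have hL1 : (1 : ℝ) ≤ L := by exact_mod_cast hL
  have hL0 : (0 : ℝ) < L := by exact_mod_cast (show 0 < L by omega)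
  have hη : 0 < i.η := i.hη
  have hLk : (0 : ℝ) < (L : ℝ) ^ i.k := by positivity
  haveI : Nontrivial (Fin d) := Fin.nontrivial_iff_two_le.mpr hd2
  obtain ⟨τ₀⟩ : Nonempty (Fin d) := ⟨⟨0, by omega⟩⟩
  have hside : ∀ (j : ℕ) (y : Site d) (τ : Fin d), SideTouches (i.Ω j) y τ := by
    intro j y τ
    rw [hΩ j]
    obtain ⟨κ, hκ⟩ := exists_ne τ
    exact sideTouches_of_bondTouches hκ (Or.inl (Set.mem_univ y))
  -- the window point `α₀ = α₁ = s`
  obtain ⟨s, hs⟩ : ∃ s : ℝ, s = min (c₁ / 2) (1 / 16) := ⟨_, rfl⟩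
  have hs0 : 0 < s := by rw [hs]; exact lt_min (by linarith) (by norm_num)
  have hsc2 : s ≤ c₁ / 2 := by rw [hs]; exact min_le_left _ _
  have hsc : s + s ≤ c₁ := by linarith
  have hs16 : s ≤ 1 / 16 := by rw [hs]; exact min_le_right _ _
  -- THE WITNESS: `a = (s/2η)·1`, `g = e^{iηa}`, the one-site bump `w`, its pure gauge `W = gaugeAct w 1`
  obtain ⟨t, ht⟩ : ∃ t : ℝ, t = s / 2 * i.η⁻¹ := ⟨_, rfl⟩
  have ht0 : 0 < t := by rw [ht]; positivity
  obtain ⟨a, ha⟩ : ∃ a : 𝔸, a = ((t : ℝ) : ℂ) • (1 : 𝔸) := ⟨_, rfl⟩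
  have ha_sa : IsSelfAdjoint a := by rw [ha]; exact B8Eq155JBound.isSelfAdjoint_real_smul t (IsSelfAdjoint.one 𝔸)
  have ha_norm : ‖a‖ = t := by rw [ha, norm_smul, Complex.norm_real, Real.norm_of_nonneg ht0.le, norm_one, mul_one]
  have hX : ‖((I : ℂ) • (i.η • a) : 𝔸)‖ ≤ s / 2 := by
    rw [norm_smul, Complex.norm_I, one_mul, norm_smul, Real.norm_eq_abs, abs_of_pos hη, ha_norm, ht]
    rw [show i.η * (s / 2 * i.η⁻¹) = s / 2 by field_simp]
  obtain ⟨g, hg⟩ : ∃ g : 𝔸ˣ, g = expUnit ((I : ℂ) • (i.η • a)) := ⟨_, rfl⟩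
  have hgu : g ∈ unitaryUnits 𝔸 := by
    rw [B7Prop2Explicit.mem_unitaryUnits, hg, val_expUnit]
    exact B8Ineq170.exp_I_smul_mem_unitary (B8Prop5Reality.isSelfAdjoint_real_smul i.η ha_sa)
  have hs2 : s / 2 ≤ 1 := by linarith
  have hg1 : ‖((g : 𝔸ˣ) : 𝔸) - 1‖ ≤ s := by
    rw [hg, val_expUnit]
    have h := norm_exp_sub_one_le_two_mul hX hs2
    linarith
  have hg1' : ‖((g⁻¹ : 𝔸ˣ) : 𝔸) - 1‖ ≤ s := by
    rw [hg, val_inv_expUnit, val_expUnit]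
    have hX' : ‖(-((I : ℂ) • (i.η • a)) : 𝔸)‖ ≤ s / 2 := by rw [norm_neg]; exact hX
    have h := norm_exp_sub_one_le_two_mul hX' hs2
    linarith
  obtain ⟨w, hw⟩ : ∃ w : Site d → 𝔸ˣ, w = fun y => if y = e τ₀ then g else 1 := ⟨_, rfl⟩
  have hwval : ∀ y, w y = g ∨ w y = 1 := by
    intro y; rw [hw]; simp only; split_ifs
    · exact Or.inl rfl
    · exact Or.inr rfl
  have hwu : ∀ y, w y ∈ unitaryUnits 𝔸 := by
    intro y
    rcases hwval y with h | h
    · rw [h]; exact hgu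
    · rw [h]; exact (unitaryUnits 𝔸).one_mem
  have hw1 : ∀ y, w y ∈ B7Prop1Explicit.U1 𝔸 := fun y => unitaryUnits_le_U1 (hwu y)
  -- every `w a · (w b)⁻¹` is `1`, `g` or `g⁻¹`: within `s` of `1`
  have hpair : ∀ a₁ b₁ : Site d, ‖((w a₁ * (w b₁)⁻¹ : 𝔸ˣ) : 𝔸) - 1‖ ≤ s := by
    intro a₁ b₁
    rcases hwval a₁ with h₁ | h₁ <;> rcases hwval b₁ with h₂ | h₂ <;> rw [h₁, h₂]
    · rw [mul_inv_cancel, Units.val_one, sub_self, norm_zero]; exact hs0.le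
    · rw [inv_one, mul_one]; exact hg1
    · rw [one_mul]; exact hg1'
    · rw [inv_one, mul_one, Units.val_one, sub_self, norm_zero]; exact hs0.le
  obtain ⟨W, hW⟩ : ∃ W : Site d → Fin d → 𝔸ˣ, W = gaugeAct w (1 : Site d → Fin d → 𝔸ˣ) := ⟨_, rfl⟩
  have hWval : ∀ (y : Site d) (κ : Fin d), W y κ = w y * (w (y + e κ))⁻¹ := by
    intro y κ; rw [hW, gaugeAct]; simp only [Pi.one_apply, mul_one]
  have hWu : ∀ y κ, W y κ ∈ unitaryUnits 𝔸 := fun y κ => by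
    rw [hWval]; exact (unitaryUnits 𝔸).mul_mem (hwu y) ((unitaryUnits 𝔸).inv_mem (hwu _))
  -- the distinguished bond `(e τ₀, τ₀)`: `W = g` there
  have he2 : e τ₀ + e τ₀ ≠ e τ₀ := by
    intro h
    have := congrFun h τ₀
    simp [Pi.add_apply, e_apply] at this
  have hWb : W (e τ₀) τ₀ = g := by
    rw [hWval, hw]
    simp [he2]
  -- the data of the clause
  have h1u : ∀ (x : Site d) (κ : Fin d), (1 : Site d → Fin d → 𝔸ˣ) x κ ∈ unitaryUnits 𝔸 := fun _ _ => (unitaryUnits 𝔸).one_mem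
  have hmul : mulCfg W (1 : Site d → Fin d → 𝔸ˣ) = W := by rw [mulCfg_eq_mul, mul_one]
  have hInA : InAk L i.k i.η s i.Ω (1 : Site d → Fin d → 𝔸ˣ) := one_inAk hL i.k hη hs0 _
  have hInAk' : InAk L i.k i.η s i.Ω (mulCfg W (1 : Site d → Fin d → 𝔸ˣ)) := by
    rw [hmul, hW]
    exact (inAk_gaugeAct_iff L i.k i.η s i.Ω hw1 _).mpr hInA
  have hAx : ∀ m, m ≤ i.k → InAx L m (i.Λs m) (1 : Site d → Fin d → 𝔸ˣ) (mulCfg W (1 : Site d → Fin d → 𝔸ˣ)) := by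
    intro m _ j hj1 _ xj hxj
    rw [hΛs m j] at hxj
    have : j = 0 := hxj
    omega
  have havg : ∀ j, j ≤ i.k → ∀ (z : Site d) (μ : Fin d), (∀ x, InBox (loK L j z) (bondHiK L j z μ) x → x ∈ i.Ω j) →
      ‖(avgIter L (mulCfg W (1 : Site d → Fin d → 𝔸ˣ)) j z μ : 𝔸) - (avgIter L (1 : Site d → Fin d → 𝔸ˣ) j z μ : 𝔸)‖ ≤ s := by
    intro j _ z μ _
    rw [hmul, hW, avgIter_gaugeAct_units L w _ j, avgIter_one L j, gaugeAct]
    simp only [uLev_apply, Pi.one_apply, mul_one, Units.val_one]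
    exact hpair _ _
  have h166 : ∀ b ∈ {b : Site d × Fin d | SideTouches (i.Ω 0) b.1 b.2}, ‖((W b.1 b.2 : 𝔸ˣ) : 𝔸) - 1‖ ≤ s := by
    intro b _
    rw [hWval]
    exact hpair _ _
  -- apply the clause
  obtain ⟨u, hR, ⟨-, -, h162⟩, -⟩ :=
    H s s hs0 hs0 hsc ⟨1, h1u⟩ (⟨1, h1u⟩, ⟨W, hWu⟩) hInA trivial ⟨rfl, hInAk', hAx⟩ ⟨havg, h166⟩
  -- (1.29) at level 0 on every site: the gauge transformation is trivial
  have hu1 : u.1 = 1 := by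
    funext y
    have hy : y ∈ i.Λs i.k 0 := by rw [hΛs]; rfl
    have h := hR 0 (Nat.zero_le _) y hy
    rw [Rbar_zero] at h
    exact Units.val_eq_one.mp h
  have hact : mgauge (1 : Site d → Fin d → 𝔸ˣ) u.1⁻¹ W = W := by
    funext x κ
    rw [mgauge_apply, hu1]
    simp only [inv_one, Pi.one_apply, B7Eq92Concrete.Rc_one_apply, one_mul, mul_one]
  -- (1.62) at the top level on the bond `(e τ₀, τ₀)`
  obtain ⟨-, -, hbd⟩ := h162 i.k le_rfl (e τ₀, τ₀) (hside i.k _ _)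
  change ‖logCfg i.η (mgauge (1 : Site d → Fin d → 𝔸ˣ) u.1⁻¹ W) (e τ₀) τ₀‖ ≤ B₁' * (s + s) * ((L : ℝ) ^ i.k * i.η)⁻¹ at hbd
  rw [hact] at hbd
  -- the canonical logarithm of `W` at that bond is `a`
  have hWA : W (e τ₀) τ₀ = cfgExp i.η (fun _ _ => a) (e τ₀) τ₀ := by
    rw [hWb, hg]; exact Units.ext (by rw [val_expUnit, cfgExp, val_expUnit])
  have hA : ‖(fun (_ : Site d) (_ : Fin d) => a) (e τ₀) τ₀‖ ≤ (s / 2) * i.η⁻¹ := by simp only [ha_norm, ht, le_refl]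
  have hlog := (logField_spec hη (1 : Site d → Fin d → 𝔸ˣ) hWu hWA hA (by linarith)).1
  have hval : logCfg i.η W (e τ₀) τ₀ = a := hlog
  rw [hval, ha_norm, ht] at hbd
  -- `s/(2η) ≤ 2B₁′s/(Lᵏη)` ⟹ `Lᵏ ≤ 4B₁′`
  have h' : s / 2 * ((L : ℝ) ^ i.k) ≤ B₁' * (s + s) := by
    have h1 := mul_le_mul_of_nonneg_right hbd (by positivity : (0 : ℝ) ≤ (L : ℝ) ^ i.k * i.η)
    have e1 : s / 2 * i.η⁻¹ * ((L : ℝ) ^ i.k * i.η) = s / 2 * (L : ℝ) ^ i.k := by field_simp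
    have e2 : B₁' * (s + s) * ((L : ℝ) ^ i.k * i.η)⁻¹ * ((L : ℝ) ^ i.k * i.η) = B₁' * (s + s) := by field_simp
    rwa [e1, e2] at h1
  nlinarith

end Clause

/-! ## §2 A univ member with all constraint sites at level 0 (admissible in `ZdIdx`; violates the cover law №11 of `B8IdxB8LawsB`) -/

/-- **A member of `ZdIdx d L` with `Ω_j = ℤᵈ` for every `j`, `k ≥ 1` levels, spacing `η > 0`, ALL constraint sites at level 0 (`Λs m j = {j = 0}`: every site is its own
level-0 tower) and empty bond classes** — admissible: `htower` and `hpart` hold with the one-point towers (`tlo L y 0 = thi L y 0 = y`), `hbox`∕`hclass` are vacuous.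
It violates node N05's cover law №11 ((1.5)–(1.6): above a level-`ℓ ≥ 1` box there must be a constraint site of level `≥ ℓ`). [cite: Balaban1985RegularSpaces, (1.3)–(1.6) p.77, (1.28)–(1.29) p.81] -/
theorem exists_member_univ_levelZero {L : ℕ} {k : ℕ} (hk : 1 ≤ k) {η : ℝ} (hη : 0 < η) :
    ∃ i : ZdIdx d L, i.Ω 0 = Set.univ ∧ i.k = k ∧ i.η = η ∧ (∀ j, i.Ω j = Set.univ) ∧
      (∀ m j, i.Λs m j = {_y | j = 0}) ∧ (∀ m j, i.Λb m j = ∅) := by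
  classical
  refine ⟨⟨η, hη, k, hk, fun _ => Set.univ, fun _ => le_rfl, fun m j => {_y | j = 0}, fun _ _ => ∅,
      fun _ _ _ _ _ h _ _ => absurd h (Set.notMem_empty _), fun _ _ _ _ _ h => absurd h (Set.notMem_empty _),
      fun _ _ _ _ _ _ => Set.mem_univ _, ?_⟩,
    rfl, rfl, rfl, fun _ => rfl, fun _ _ => rfl, fun _ _ => rfl⟩
  intro x _
  refine ⟨0, Nat.zero_le _, x, rfl, ?_⟩
  intro j
  rw [tlo_zero, thi_zero]
  exact ⟨le_rfl, le_rfl⟩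

/-! ## §3 ★★ Theorem 4 as typed on the law-free univ sub-family of `zdGF3` (and on all of `ZdIdx`) is FALSE -/

section Printed

variable {𝔸 : Type} [CStarAlgebra 𝔸] [Nontrivial 𝔸]

/-- ★★ **`B8.Thm4Printed` ON THE LAW-FREE UNIV SUB-FAMILY OF `zdGF3` IS FALSE** (`d ≥ 2`, `L ≥ 2`, any `β, len`, EVERY constant `B₁′`, every nontrivial C⋆-algebra):
`¬ B8.Thm4Printed B₁′ (fun i : {i : ZdIdx d L // i.Ω 0 = univ} ↦ (zdGF3 𝔸 L β len i.1).toGFData)` — for every threshold `c₁ > 0` the clause fails at the member of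
`exists_member_univ_levelZero` with `Lᵏ > 4B₁′` (`L ≥ 2`: such `k` exists).  CONSEQUENCE: every theorem taking this hypothesis (or `B8.Thm4Body c₁ B₁′` on that family) is
VACUOUS as stated; node N05's Theorem 4 must be read on a sub-index with the cover law (e.g. `IdxB8SubB`, or the all-torus proper members).  Nothing printed is refuted.
[cite: Balaban1985RegularSpaces, Thm 4 p.88, (1.29) p.81, (1.62) p.87, (1.5)–(1.6) p.77] -/
theorem not_thm4Printed_zdGF3_univ (hd2 : 2 ≤ d) {L : ℕ} (hL : 2 ≤ L) (β : ℝ) (len : Site d → ℝ) (B₁' : ℝ) :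
    ¬ B8.Thm4Printed B₁' (fun i : {i : ZdIdx d L // i.Ω 0 = Set.univ} => (zdGF3 𝔸 L β len i.1).toGFData) := by
  rintro ⟨c₁, hc₁, H⟩
  have hL1 : 1 ≤ L := le_trans (by norm_num) hL
  have hLr : (1 : ℝ) < L := by exact_mod_cast (show 1 < L by omega)
  obtain ⟨n, hn⟩ := pow_unbounded_of_one_lt (4 * B₁') hLr
  have hk : 4 * B₁' < (L : ℝ) ^ (n + 1) :=
    hn.trans_le (pow_le_pow_right₀ hLr.le (Nat.le_succ n))
  obtain ⟨i, hΩ0, hik, -, hΩ, hΛs, -⟩ := exists_member_univ_levelZero (d := d) (L := L) (k := n + 1) (Nat.succ_pos n) one_pos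
  have hk' : 4 * B₁' < (L : ℝ) ^ i.k := by rw [hik]; exact hk
  exact thm4Clause_false_of_levelZero hd2 hL1 β len i hΩ hΛs hc₁ hk' (H ⟨i, hΩ0⟩)

/-- **… AND ON THE WHOLE INDEX** (the family of n05-a's `B8LeafModelZd3.thm4Printed_zd3`, whose conclusion is therefore false — its four socket binders are jointly
unsatisfiable, as `B8SockH59NotAtUnivDegenerate.not_forall_sockH59` already shows). [cite: Balaban1985RegularSpaces, Thm 4 p.88, (1.5)–(1.6) p.77] -/
theorem not_thm4Printed_zdGF3 (hd2 : 2 ≤ d) {L : ℕ} (hL : 2 ≤ L) (β : ℝ) (len : Site d → ℝ) (B₁' : ℝ) :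
    ¬ B8.Thm4Printed B₁' (fun i : ZdIdx d L => (zdGF3 𝔸 L β len i).toGFData) := by
  rintro ⟨c₁, hc₁, H⟩
  exact not_thm4Printed_zdGF3_univ hd2 hL β len B₁' ⟨c₁, hc₁, fun i => H i.1⟩

/-- **… AND ON n05-c's REPAIRED CARRIER `zdGF3H`** (which changes only the Theorem-8 source field `InR`; its `GFData` part IS `zdGF3`'s, definitionally).
[cite: Balaban1985RegularSpaces, Thm 4 p.88, Thm 8 (1.146) p.101] -/
theorem not_thm4Printed_zdGF3H_univ (hd2 : 2 ≤ d) {L : ℕ} (hL : 2 ≤ L) (β : ℝ) (len : Site d → ℝ) (B₁' : ℝ) :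
    ¬ B8.Thm4Printed B₁' (fun i : {i : ZdIdx d L // i.Ω 0 = Set.univ} => (zdGF3H 𝔸 L β len i.1).toGFData) :=
  not_thm4Printed_zdGF3_univ hd2 hL β len B₁'

end Printed

#print axioms not_thm4Printed_zdGF3_univ

end Literature.MathematicalPhysics.QuantumFieldTheory.Balaban1983to89.B8Thm4BodyNotAtUnivLevelZero

end
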